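import Summits.BirchSwinnertonDyer.BirchSwinnertonDyer.Theorems.ManinLocalTwoThreeTameAdditiveTypesAtThree
import Summits.BirchSwinnertonDyer.BirchSwinnertonDyer.Theorems.ManinLocalTwoThreeTameThreeIIINormalForm
import Summits.BirchSwinnertonDyer.BirchSwinnertonDyer.Theorems.ManinLocalTwoThreeTameTwoIVstarVeluB
import Summits.BirchSwinnertonDyer.BirchSwinnertonDyer.Theorems.ManinLocalTwoThreeVeluThreeIsogenous
import Summits.BirchSwinnertonDyer.BirchSwinnertonDyer.Theorems.ManinLocalTwoThreeNoAscendingTameThree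
import Literature.NumberTheory.EllipticCurves.NeronComponentIndexTypeI0starProofs
import HarnessLib

/-!
# The tame `I₀*` stratum at `3` with a rational `3`-line: `ord₃ D₀ = 0` with `3⁴ ∣ 1440q² − 9c₄`, or `ord₃ D₀ ≥ 3`
# (the local half of E-an-109 for rational kernels)

Summit `BirchSwinnertonDyer`, route `ManinLocalTwoThree` (cell bsd-f2-manin), deciding crux C3 `ManinPrimeToThreeAtNine`
(stmt-BirchSwinnertonDyer-22968).  `W/ℚ` globally minimal, `9 ∥ N`, `ord₃ Δ_min = 6` (Kodaira `I₀*` at `3`, by p650740's classification),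
`q ∈ ℚ` with `Ψ₃_W(q − b₂/12) = 0`; `D₀ = Ψ₂²_W(q − b₂/12) = 4q³ − c₄q/12 − c₆/216`.  On Tate's `I₀*` normal form over `ℤ₃`
(`[3α₁, 3α₂, 9α₃, 9α₄, 27α₆]`; `exists_smul_of_kodairaSymbolOfMinimal_eq_Istar_zero`), reached from `W ⊗ ℚ₃` by a change of
variables with `‖u‖₃ = 1`, the torsion abscissa `x` is a `3`-adic integer (root of `3x⁴ + b₂x³ + 3b₄x² + 3b₆x + b₈`); if `x` is a UNIT
then `3 ∣ x + α₂`, `D₀ ≡ x³` is a unit and `12x + b₂ ≡ 0 (mod 9)`, so `3⁴ ∣ 10(12x + b₂)² − 9c₄ = 1440q² − 9c₄`; if `3 ∣ x` then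
`3³ ∣ D₀`.  (`Ψ₃`, `Ψ₂²` and `12x + b₂ = 12q` are covariants of weights `8, 6, 2`.)

* `exists_IstarZeroNormalForm_padicInt_three`, `kodairaSymbolOfMinimal_padicThree_eq_Istar_zero`, `map_b_of_IstarZeroNormalForm`;
* `IstarZero_root_dichotomy_padicInt` (the local analysis on the normal form);
* **`veluD₀_dichotomy_of_IstarZero_three`** — for `W` as above: (`ord₃ D₀ = 0` ∧ (`A = 0` ∨ `4 ≤ ord₃ A`)) ∨ `3 ≤ ord₃ D₀`,
  `A = 1440q² − 9c₄(W)` the first Vélu invariant.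

Sequel (next file): for a rational `3`-torsion POINT `D₀ = 4Y₁²` has even order, so `ord₃ D₀ = 0`; with conductor invariance the
`u = 1` carrier would be `I₁₂*` with `ord₃ j = −12` against `ord₃ j = 3·ord₃ A − 18 ≥ −6`: the point ASCENDS (`u = 3`).
HONEST FRAMING: local theorem; C3, Manin's conjecture and BSD are not proved.  No definitions, no named facts, no sorry.
References: [SilvermanATAEC1994] IV.9.4 Step 6, Table 4.1; [DokchitserDokchitser2015LocalInvariants] Table 1; HOME/MEMO-an.md §66 (E-an-109).
-/

set_option linter.dupNamespace false
set_option autoImplicit false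

noncomputable section

open scoped Classical

open WeierstrassCurve IsDedekindDomain IsLocalRing Polynomial
  Literature.NumberTheory.DiophantineGeometry Literature.NumberTheory.DiophantineGeometry.TateAlgorithm
  Literature.NumberTheory.EllipticCurves Literature.NumberTheory.EllipticCurves.LocalIndex
  Summit.BirchSwinnertonDyer.Rank1Residual.Additive
open IsDiscreteValuationRing hiding maximalIdeal

namespace Summit.BirchSwinnertonDyer.BirchSwinnertonDyer.Theorems.ManinLocalTwoThree

/-! ### §1 Kodaira `I₀*` over `ℤ₃` from `9 ∥ N`, `ord₃ Δ_min = 6` -/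

/-- `9 ∥ N`, `ord₃ Δ_min = 6` ⟹ Kodaira type `I₀*` at `3`. [cite: SilvermanATAEC1994, IV.9.4 Table 4.1] -/
theorem kodairaSymbolAt_placeOf_three_eq_Istar_zero (W : WeierstrassCurve ℚ) [W.IsElliptic] [W.IsGloballyMinimal]
    (h9 : 3 ^ 2 ∣ W.conductorNorm ℤ) (h27 : ¬ 3 ^ 3 ∣ W.conductorNorm ℤ) (hΔ : padicValInt 3 W.minimalDiscriminantInt = 6) :
    W.kodairaSymbolAt (placeOf 3) = .Istar 0 := by
  rcases padicValInt_three_minimalDiscriminantInt_of_nine_dvd_conductorNorm W h9 h27 with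
    ⟨-, h⟩ | ⟨h, -⟩ | ⟨-, h⟩ | ⟨n, -, h, -⟩
  · omega
  · exact h
  · omega
  · omega

/-- The same read over `ℤ₃`: Tate's algorithm returns `I₀*` on the integral minimal model of `W ⊗ ℚ₃`.
[cite: SilvermanATAEC1994, IV.9.4 Table 4.1] -/
theorem kodairaSymbolOfMinimal_padicThree_eq_Istar_zero (W : WeierstrassCurve ℚ) [W.IsElliptic] [W.IsGloballyMinimal]
    (h9 : 3 ^ 2 ∣ W.conductorNorm ℤ) (h27 : ¬ 3 ^ 3 ∣ W.conductorNorm ℤ) (hΔ : padicValInt 3 W.minimalDiscriminantInt = 6) :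
    (((W.baseChange ℚ_[3]).minimal ℤ_[3]).integralModel ℤ_[3]).kodairaSymbolOfMinimal = .Istar 0 := by
  have hK := kodairaSymbolAt_placeOf_three_eq_Istar_zero W h9 h27 hΔ
  have e : Rat.HeightOneSpectrum.primesEquiv (R := ℤ) (placeOf 3) = ⟨3, Nat.prime_three⟩ := Equiv.apply_symm_apply _ _
  have hKp := WeierstrassCurve.kodairaSymbolAt_eq_padic (R := ℤ) (placeOf 3) W
  rw [e] at hKp
  change W.kodairaSymbolAt (placeOf 3) = (((W.baseChange ℚ_[3]).minimal ℤ_[3]).integralModel ℤ_[3]).kodairaSymbolOfMinimal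
    at hKp
  rw [hK] at hKp
  exact hKp.symm

/-! ### §2 The `I₀*` normal form over `ℤ₃` -/

/-- **Tate's `I₀*` normal form over `ℤ₃`:** if Tate's algorithm returns `I₀*` on `V/ℤ₃` (`Δ ≠ 0`), some change of variables over `ℤ₃`
brings `V` to `[3α₁, 3α₂, 9α₃, 9α₄, 27α₆]`. [cite: SilvermanATAEC1994, IV.9.4 Step 6] -/
theorem exists_IstarZeroNormalForm_padicInt_three (V : WeierstrassCurve ℤ_[3]) (hΔ0 : V.Δ ≠ 0)
    (hV : V.kodairaSymbolOfMinimal = .Istar 0) :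
    ∃ (D : VariableChange ℤ_[3]) (α₁ α₂ α₃ α₄ α₆ : ℤ_[3]),
      (D • V).a₁ = 3 * α₁ ∧ (D • V).a₂ = 3 * α₂ ∧ (D • V).a₃ = 9 * α₃ ∧ (D • V).a₄ = 9 * α₄ ∧ (D • V).a₆ = 27 * α₆ := by
  haveI : Finite (ResidueField ℤ_[3]) := Finite.of_equiv _ (PadicInt.residueField (p := 3)).toEquiv.symm
  have hirr : Irreducible (3 : ℤ_[3]) := by exact_mod_cast PadicInt.irreducible_p (p := 3)
  obtain ⟨D, h1, h2, h3, h4, h6, -⟩ := exists_smul_of_kodairaSymbolOfMinimal_eq_Istar_zero V hΔ0 hV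
  obtain ⟨α₁, hα₁⟩ := (mem_maximalIdeal_iff_dvd_of_irreducible hirr _).mp h1
  obtain ⟨α₂, hα₂⟩ := (mem_maximalIdeal_iff_dvd_of_irreducible hirr _).mp h2
  obtain ⟨α₃, hα₃⟩ := (mem_maximalIdeal_pow_iff_dvd_of_irreducible hirr _ _).mp h3
  obtain ⟨α₄, hα₄⟩ := (mem_maximalIdeal_pow_iff_dvd_of_irreducible hirr _ _).mp h4
  obtain ⟨α₆, hα₆⟩ := (mem_maximalIdeal_pow_iff_dvd_of_irreducible hirr _ _).mp h6
  exact ⟨D, α₁, α₂, α₃, α₄, α₆, hα₁, hα₂, by rw [hα₃]; ring, by rw [hα₄]; ring, by rw [hα₆]; ring⟩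

/-- The `b`-invariants and `c₄` of the `I₀*` normal form, read in `ℚ₃`: `b₂ = 3B₂`, `b₄ = 9B₄`, `b₆ = 27B₆`, `b₈ = 81B₈`, `c₄ = 9(B₂² − 24B₄)`.
[folklore] -/
theorem map_b_of_IstarZeroNormalForm (M : WeierstrassCurve ℤ_[3]) {α₁ α₂ α₃ α₄ α₆ : ℤ_[3]} (h₁ : M.a₁ = 3 * α₁)
    (h₂ : M.a₂ = 3 * α₂) (h₃ : M.a₃ = 9 * α₃) (h₄ : M.a₄ = 9 * α₄) (h₆ : M.a₆ = 27 * α₆) :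
    (M.map PadicInt.Coe.ringHom).b₂ = 3 * ((3 * α₁ ^ 2 + 4 * α₂ : ℤ_[3]) : ℚ_[3]) ∧
      (M.map PadicInt.Coe.ringHom).b₄ = 9 * ((2 * α₄ + 3 * α₁ * α₃ : ℤ_[3]) : ℚ_[3]) ∧
      (M.map PadicInt.Coe.ringHom).b₆ = 27 * ((3 * α₃ ^ 2 + 4 * α₆ : ℤ_[3]) : ℚ_[3]) ∧
      (M.map PadicInt.Coe.ringHom).b₈ =
        81 * ((3 * α₁ ^ 2 * α₆ + 4 * α₂ * α₆ - 3 * α₁ * α₃ * α₄ + 3 * α₂ * α₃ ^ 2 - α₄ ^ 2 : ℤ_[3]) : ℚ_[3]) ∧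
      (M.map PadicInt.Coe.ringHom).c₄ =
        9 * (((3 * α₁ ^ 2 + 4 * α₂ : ℤ_[3]) : ℚ_[3]) ^ 2 - 24 * ((2 * α₄ + 3 * α₁ * α₃ : ℤ_[3]) : ℚ_[3])) := by
  have e : ∀ z : ℤ_[3], (PadicInt.Coe.ringHom (p := 3)) z = (z : ℚ_[3]) := fun z => rfl
  have c2 : ((2 : ℤ_[3]) : ℚ_[3]) = 2 := by exact_mod_cast PadicInt.coe_natCast 2
  have c3 : ((3 : ℤ_[3]) : ℚ_[3]) = 3 := by exact_mod_cast PadicInt.coe_natCast 3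
  have c4 : ((4 : ℤ_[3]) : ℚ_[3]) = 4 := by exact_mod_cast PadicInt.coe_natCast 4
  have c9 : ((9 : ℤ_[3]) : ℚ_[3]) = 9 := by exact_mod_cast PadicInt.coe_natCast 9
  have c27 : ((27 : ℤ_[3]) : ℚ_[3]) = 27 := by exact_mod_cast PadicInt.coe_natCast 27
  simp only [WeierstrassCurve.c₄, WeierstrassCurve.b₂, WeierstrassCurve.b₄, WeierstrassCurve.b₆, WeierstrassCurve.b₈, map_a₁,
    map_a₂, map_a₃, map_a₄, map_a₆, h₁, h₂, h₃, h₄, h₆, e]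
  push_cast
  simp only [c2, c3, c4, c9, c27]
  refine ⟨by ring, by ring, by ring, by ring, by ring⟩

/-! ### §3 The local analysis of a `Ψ₃`-root on the normal form -/

/-- **The `I₀*` root dichotomy.**  On a `ℤ₃`-model `[3α₁, 3α₂, 9α₃, 9α₄, 27α₆]`, a root `x ∈ ℚ₃` of `3x⁴ + b₂x³ + 3b₄x² + 3b₆x + b₈`
is integral, and either `D = 4x³ + b₂x² + 2b₄x + b₆` is a unit with `‖10(12x + b₂)² − 9c₄‖ ≤ 3⁻⁴`, or `‖D‖ ≤ 3⁻³`.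
[cite: SilvermanATAEC1994, IV.9.4 Step 6] -/
theorem IstarZero_root_dichotomy_padicInt (M : WeierstrassCurve ℤ_[3]) {α₁ α₂ α₃ α₄ α₆ : ℤ_[3]} (h₁ : M.a₁ = 3 * α₁)
    (h₂ : M.a₂ = 3 * α₂) (h₃ : M.a₃ = 9 * α₃) (h₄ : M.a₄ = 9 * α₄) (h₆ : M.a₆ = 27 * α₆) {x : ℚ_[3]}
    (hx : 3 * x ^ 4 + (M.map PadicInt.Coe.ringHom).b₂ * x ^ 3 + 3 * (M.map PadicInt.Coe.ringHom).b₄ * x ^ 2 +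
      3 * (M.map PadicInt.Coe.ringHom).b₆ * x + (M.map PadicInt.Coe.ringHom).b₈ = 0) :
    (‖4 * x ^ 3 + (M.map PadicInt.Coe.ringHom).b₂ * x ^ 2 + 2 * (M.map PadicInt.Coe.ringHom).b₄ * x +
        (M.map PadicInt.Coe.ringHom).b₆‖ = 1 ∧
      ‖10 * (12 * x + (M.map PadicInt.Coe.ringHom).b₂) ^ 2 - 9 * (M.map PadicInt.Coe.ringHom).c₄‖ ≤ 3⁻¹ ^ 4) ∨
    ‖4 * x ^ 3 + (M.map PadicInt.Coe.ringHom).b₂ * x ^ 2 + 2 * (M.map PadicInt.Coe.ringHom).b₄ * x +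
        (M.map PadicInt.Coe.ringHom).b₆‖ ≤ 3⁻¹ ^ 3 := by
  obtain ⟨hb₂, hb₄, hb₆, hb₈, hc₄⟩ := map_b_of_IstarZeroNormalForm M h₁ h₂ h₃ h₄ h₆
  set B₂ : ℤ_[3] := 3 * α₁ ^ 2 + 4 * α₂ with hB₂
  set B₄ : ℤ_[3] := 2 * α₄ + 3 * α₁ * α₃ with hB₄
  set B₆ : ℤ_[3] := 3 * α₃ ^ 2 + 4 * α₆ with hB₆
  set B₈ : ℤ_[3] := 3 * α₁ ^ 2 * α₆ + 4 * α₂ * α₆ - 3 * α₁ * α₃ * α₄ + 3 * α₂ * α₃ ^ 2 - α₄ ^ 2 with hB₈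
  rw [hb₂, hb₄, hb₆, hb₈] at hx
  rw [hb₂, hb₄, hb₆, hc₄]
  have c2 : ((2 : ℤ_[3]) : ℚ_[3]) = 2 := by exact_mod_cast PadicInt.coe_natCast 2
  have c3 : ((3 : ℤ_[3]) : ℚ_[3]) = 3 := by exact_mod_cast PadicInt.coe_natCast 3
  have c4 : ((4 : ℤ_[3]) : ℚ_[3]) = 4 := by exact_mod_cast PadicInt.coe_natCast 4
  have c9 : ((9 : ℤ_[3]) : ℚ_[3]) = 9 := by exact_mod_cast PadicInt.coe_natCast 9
  have c10 : ((10 : ℤ_[3]) : ℚ_[3]) = 10 := by exact_mod_cast PadicInt.coe_natCast 10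
  have c12 : ((12 : ℤ_[3]) : ℚ_[3]) = 12 := by exact_mod_cast PadicInt.coe_natCast 12
  have c24 : ((24 : ℤ_[3]) : ℚ_[3]) = 24 := by exact_mod_cast PadicInt.coe_natCast 24
  have c27 : ((27 : ℤ_[3]) : ℚ_[3]) = 27 := by exact_mod_cast PadicInt.coe_natCast 27
  have c81 : ((81 : ℤ_[3]) : ℚ_[3]) = 81 := by exact_mod_cast PadicInt.coe_natCast 81
  have hirr : Irreducible (3 : ℤ_[3]) := by exact_mod_cast PadicInt.irreducible_p (p := 3)
  have h3n : ‖(3 : ℚ_[3])‖ = 3⁻¹ := by have := Padic.norm_p (p := 3); exact_mod_cast this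
  have hm1 : ∀ m : ℤ_[3], ‖(m : ℚ_[3])‖ ≤ 1 := fun m => by rw [← PadicInt.norm_def]; exact PadicInt.norm_le_one m
  -- (i) `x` is a `3`-adic integer
  have hxle : ‖x‖ ≤ 1 := by
    by_contra hlt
    rw [not_le] at hlt
    have hx0 : 0 < ‖x‖ := lt_trans zero_lt_one hlt
    -- `3x⁴ = −(b₂x³ + 3b₄x² + 3b₆x + b₈)` and every term on the right is `< ‖x‖⁴/3`
    have hlead : ‖3 * x ^ 4‖ = 3⁻¹ * ‖x‖ ^ 4 := by rw [norm_mul, norm_pow, h3n]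
    have e : 3 * x ^ 4 = -((3 * (B₂ : ℚ_[3])) * x ^ 3 + 3 * (9 * (B₄ : ℚ_[3])) * x ^ 2 + 3 * (27 * (B₆ : ℚ_[3])) * x +
        81 * (B₈ : ℚ_[3])) := by linear_combination hx
    have t1 : ‖(3 * (B₂ : ℚ_[3])) * x ^ 3‖ < 3⁻¹ * ‖x‖ ^ 4 := by
      rw [norm_mul, norm_mul, norm_pow, h3n]
      calc 3⁻¹ * ‖(B₂ : ℚ_[3])‖ * ‖x‖ ^ 3 ≤ 3⁻¹ * 1 * ‖x‖ ^ 3 := by gcongr; exact hm1 _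
        _ < 3⁻¹ * ‖x‖ ^ 4 := by
          rw [mul_one]
          have : ‖x‖ ^ 3 < ‖x‖ ^ 4 := by
            calc ‖x‖ ^ 3 = ‖x‖ ^ 3 * 1 := by ring
              _ < ‖x‖ ^ 3 * ‖x‖ := by gcongr
              _ = ‖x‖ ^ 4 := by ring
          linarith
    have hx1 : (1 : ℝ) ≤ ‖x‖ := hlt.le
    have hx4 : (1 : ℝ) ≤ ‖x‖ ^ 4 := one_le_pow₀ hx1
    have t2 : ‖3 * (9 * (B₄ : ℚ_[3])) * x ^ 2‖ < 3⁻¹ * ‖x‖ ^ 4 := by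
      rw [norm_mul, norm_mul, norm_mul, norm_pow, h3n, show (9 : ℚ_[3]) = 3 ^ 2 by norm_num, norm_pow, h3n]
      calc 3⁻¹ * ((3⁻¹) ^ 2 * ‖(B₄ : ℚ_[3])‖) * ‖x‖ ^ 2 ≤ 3⁻¹ * ((3⁻¹) ^ 2 * 1) * ‖x‖ ^ 2 := by gcongr; exact hm1 _
        _ < 3⁻¹ * ‖x‖ ^ 4 := by
          have : ‖x‖ ^ 2 ≤ ‖x‖ ^ 4 := pow_le_pow_right₀ hx1 (by norm_num)
          nlinarith
    have t3 : ‖3 * (27 * (B₆ : ℚ_[3])) * x‖ < 3⁻¹ * ‖x‖ ^ 4 := by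
      rw [norm_mul, norm_mul, norm_mul, h3n, show (27 : ℚ_[3]) = 3 ^ 3 by norm_num, norm_pow, h3n]
      calc 3⁻¹ * ((3⁻¹) ^ 3 * ‖(B₆ : ℚ_[3])‖) * ‖x‖ ≤ 3⁻¹ * ((3⁻¹) ^ 3 * 1) * ‖x‖ := by gcongr; exact hm1 _
        _ < 3⁻¹ * ‖x‖ ^ 4 := by
          have : ‖x‖ ≤ ‖x‖ ^ 4 := le_self_pow₀ hx1 (by norm_num)
          nlinarith
    have t4 : ‖81 * (B₈ : ℚ_[3])‖ < 3⁻¹ * ‖x‖ ^ 4 := by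
      rw [norm_mul, show (81 : ℚ_[3]) = 3 ^ 4 by norm_num, norm_pow, h3n]
      calc (3⁻¹) ^ 4 * ‖(B₈ : ℚ_[3])‖ ≤ (3⁻¹) ^ 4 * 1 := by gcongr; exact hm1 _
        _ < 3⁻¹ * ‖x‖ ^ 4 := by nlinarith
    have hsum : ‖(3 * (B₂ : ℚ_[3])) * x ^ 3 + 3 * (9 * (B₄ : ℚ_[3])) * x ^ 2 + 3 * (27 * (B₆ : ℚ_[3])) * x +
        81 * (B₈ : ℚ_[3])‖ < 3⁻¹ * ‖x‖ ^ 4 :=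
      lt_of_le_of_lt (Padic.nonarchimedean _ _) (max_lt (padic_norm_add3_lt t1 t2 t3) t4)
    rw [e, norm_neg] at hlead
    exact absurd hlead (ne_of_lt hsum)
  set xz : ℤ_[3] := ⟨x, hxle⟩ with hxz
  have hxc : ((xz : ℤ_[3]) : ℚ_[3]) = x := rfl
  -- the integer equation
  have hZ : 3 * xz ^ 4 + 3 * B₂ * xz ^ 3 + 27 * B₄ * xz ^ 2 + 81 * B₆ * xz + 81 * B₈ = 0 := by
    have h : ((3 * xz ^ 4 + 3 * B₂ * xz ^ 3 + 27 * B₄ * xz ^ 2 + 81 * B₆ * xz + 81 * B₈ : ℤ_[3]) : ℚ_[3]) = 0 := by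
      push_cast; rw [c3, c27, c81, hxc]; linear_combination hx
    exact PadicInt.coe_eq_zero.mp h
  -- the two quantities, as integers
  have hD : 4 * x ^ 3 + 3 * ((B₂ : ℤ_[3]) : ℚ_[3]) * x ^ 2 + 2 * (9 * ((B₄ : ℤ_[3]) : ℚ_[3])) * x + 27 * ((B₆ : ℤ_[3]) : ℚ_[3]) =
      ((4 * xz ^ 3 + 3 * B₂ * xz ^ 2 + 18 * B₄ * xz + 27 * B₆ : ℤ_[3]) : ℚ_[3]) := by
    push_cast; rw [c3, c4, c27, hxc]
    have c18 : ((18 : ℤ_[3]) : ℚ_[3]) = 18 := by exact_mod_cast PadicInt.coe_natCast 18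
    rw [c18]; ring
  have hA : 10 * (12 * x + 3 * ((B₂ : ℤ_[3]) : ℚ_[3])) ^ 2 -
      9 * (9 * (((B₂ : ℤ_[3]) : ℚ_[3]) ^ 2 - 24 * ((B₄ : ℤ_[3]) : ℚ_[3]))) =
      ((10 * (12 * xz + 3 * B₂) ^ 2 - 81 * (B₂ ^ 2 - 24 * B₄) : ℤ_[3]) : ℚ_[3]) := by
    push_cast; rw [c3, c10, c12, c24, c81, hxc]; ring
  rw [hD, hA]
  by_cases hxu : IsUnit xz
  · ---------------------------------------------------------------- Case A: `x` a unit
    left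
    -- `3 ∣ x + B₂`
    have hdiv : (3 : ℤ_[3]) ∣ xz ^ 3 * (xz + B₂) := by
      refine ⟨-(3 * B₄ * xz ^ 2 + 9 * B₆ * xz + 9 * B₈), ?_⟩
      have h3ne : (3 : ℤ_[3]) ≠ 0 := hirr.ne_zero
      have := hZ
      apply mul_left_cancel₀ h3ne
      linear_combination hZ
    have hdiv' : (3 : ℤ_[3]) ∣ xz + B₂ := by
      have hp : Prime (3 : ℤ_[3]) := hirr.prime
      rcases hp.dvd_or_dvd hdiv with h | h
      · exact absurd (hp.dvd_of_dvd_pow h) (fun h3 ↦ hp.not_unit (isUnit_of_dvd_unit h3 hxu))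
      · exact h
    obtain ⟨w, hw⟩ := hdiv'
    -- `D = x³ + 9(…)` is a unit
    have hDu : IsUnit (4 * xz ^ 3 + 3 * B₂ * xz ^ 2 + 18 * B₄ * xz + 27 * B₆) := by
      have e : 4 * xz ^ 3 + 3 * B₂ * xz ^ 2 + 18 * B₄ * xz + 27 * B₆ =
          xz ^ 3 + 3 * (3 * w * xz ^ 2 + 6 * B₄ * xz + 9 * B₆) := by linear_combination (3 * xz ^ 2) * hw
      rw [e]
      exact isUnit_add_mul_of_isUnit hirr (hxu.pow 3) _
    refine ⟨by rw [← PadicInt.norm_def]; exact PadicInt.isUnit_iff.mp hDu, ?_⟩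
    -- `A = 81·(…)`
    have e : 10 * (12 * xz + 3 * B₂) ^ 2 - 81 * (B₂ ^ 2 - 24 * B₄) = 81 * (10 * (xz + w) ^ 2 - B₂ ^ 2 + 24 * B₄) := by
      linear_combination (90 * (4 * xz + B₂) + 270 * (xz + w)) * hw
    rw [e, PadicInt.coe_mul, norm_mul, c81, show (81 : ℚ_[3]) = 3 ^ 4 by norm_num, norm_pow, h3n]
    exact mul_le_of_le_one_right (by positivity) (hm1 _)
  · ---------------------------------------------------------------- Case B: `3 ∣ x`
    right
    obtain ⟨z, hz⟩ := padicInt_three_eq_three_mul_of_not_isUnit hxu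
    have e : 4 * xz ^ 3 + 3 * B₂ * xz ^ 2 + 18 * B₄ * xz + 27 * B₆ = 27 * (4 * z ^ 3 + B₂ * z ^ 2 + 2 * B₄ * z + B₆) := by
      rw [hz]; ring
    rw [e, PadicInt.coe_mul, norm_mul, c27, show (27 : ℚ_[3]) = 3 ^ 3 by norm_num, norm_pow, h3n]
    exact mul_le_of_le_one_right (by positivity) (hm1 _)


/-! ### §4 Transport to a globally minimal `W/ℚ` -/

/-- **The local half of E-an-109 for rational kernels.**  `W` globally minimal, `9 ∥ N`, `ord₃ Δ_min = 6` (tame `I₀*`), `q ∈ ℚ` with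
`Ψ₃_W(q − b₂/12) = 0`, `D₀ = Ψ₂²_W(q − b₂/12)`, `A = 1440q² − 9c₄(W)`: EITHER `ord₃ D₀ = 0` and (`A = 0` or `ord₃ A ≥ 4`), OR
`ord₃ D₀ ≥ 3`. [cite: SilvermanATAEC1994, IV.9.4 Step 6 and Table 4.1] [cite: DokchitserDokchitser2015LocalInvariants, Table 1] -/
theorem veluD₀_dichotomy_of_IstarZero_three (W : WeierstrassCurve ℚ) [W.IsElliptic] [W.IsGloballyMinimal]
    (h9 : 3 ^ 2 ∣ W.conductorNorm ℤ) (h27 : ¬ 3 ^ 3 ∣ W.conductorNorm ℤ) (hΔ6 : padicValInt 3 W.minimalDiscriminantInt = 6)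
    (q : ℚ) (hq : W.Ψ₃.eval (q - W.b₂ / 12) = 0) :
    (padicValRat 3 (W.Ψ₂Sq.eval (q - W.b₂ / 12)) = 0 ∧
        (1440 * q ^ 2 - 9 * W.c₄ = 0 ∨ 4 ≤ padicValRat 3 (1440 * q ^ 2 - 9 * W.c₄))) ∨
      3 ≤ padicValRat 3 (W.Ψ₂Sq.eval (q - W.b₂ / 12)) := by
  haveI : Fact (Nat.Prime 3) := ⟨Nat.prime_three⟩
  have hKp := kodairaSymbolOfMinimal_padicThree_eq_Istar_zero W h9 h27 hΔ6
  set X : WeierstrassCurve ℚ_[3] := W.baseChange ℚ_[3] with hX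
  set V₀ : WeierstrassCurve ℤ_[3] := (X.minimal ℤ_[3]).integralModel ℤ_[3] with hV₀
  set E : WeierstrassCurve.VariableChange ℚ_[3] := (X.exists_isMinimal ℤ_[3]).choose with hE
  have hmin : X.minimal ℤ_[3] = E • X := rfl
  have hV₀X : V₀.baseChange ℚ_[3] = X.minimal ℤ_[3] := WeierstrassCurve.baseChange_integralModel_eq ℤ_[3] _
  have halg : algebraMap ℤ_[3] ℚ_[3] = PadicInt.Coe.ringHom := rfl
  have hrat : ∀ r : ℚ, algebraMap ℚ ℚ_[3] r = (r : ℚ_[3]) := fun r => by rw [eq_ratCast]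
  have hXb₂ : X.b₂ = (W.b₂ : ℚ_[3]) := by rw [hX, WeierstrassCurve.baseChange, map_b₂, hrat]
  have hXb₄ : X.b₄ = (W.b₄ : ℚ_[3]) := by rw [hX, WeierstrassCurve.baseChange, map_b₄, hrat]
  have hXb₆ : X.b₆ = (W.b₆ : ℚ_[3]) := by rw [hX, WeierstrassCurve.baseChange, map_b₆, hrat]
  have hXb₈ : X.b₈ = (W.b₈ : ℚ_[3]) := by rw [hX, WeierstrassCurve.baseChange, map_b₈, hrat]
  have hXc₄ : X.c₄ = (W.c₄ : ℚ_[3]) := by rw [hX, WeierstrassCurve.baseChange, map_c₄, hrat]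
  have hXΔ : X.Δ = (W.Δ : ℚ_[3]) := by rw [hX, WeierstrassCurve.baseChange, map_Δ, hrat]
  -- `Δ(V₀) ≠ 0` and the normal form
  haveI : X.IsMinimal ℤ_[3] := isMinimal_baseChange_padic_of_isGloballyMinimal' W 3
  have hXΔ0 : X.Δ ≠ 0 := by
    rw [hXΔ]; exact_mod_cast (show W.Δ ≠ 0 by rw [← WeierstrassCurve.coe_Δ']; exact W.Δ'.ne_zero)
  have hminΔ : (X.minimal ℤ_[3]).Δ ≠ 0 := by
    rw [hmin, variableChange_Δ]; exact mul_ne_zero (pow_ne_zero _ (Units.ne_zero _)) hXΔ0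
  have hV₀Δc : ((V₀.Δ : ℤ_[3]) : ℚ_[3]) = (X.minimal ℤ_[3]).Δ := by
    rw [← hV₀X, WeierstrassCurve.baseChange, map_Δ, halg]; rfl
  have hV₀Δ : V₀.Δ ≠ 0 := fun h ↦ hminΔ (by rw [← hV₀Δc, h]; rfl)
  obtain ⟨D, α₁, α₂, α₃, α₄, α₆, h₁, h₂, h₃, h₄, h₆⟩ := exists_IstarZeroNormalForm_padicInt_three V₀ hV₀Δ hKp
  set Ctot : WeierstrassCurve.VariableChange ℚ_[3] := D.map (algebraMap ℤ_[3] ℚ_[3]) * E with hCtot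
  have hCX : Ctot • X = (D • V₀).map (algebraMap ℤ_[3] ℚ_[3]) := by
    rw [hCtot, mul_smul, ← hmin, ← hV₀X]
    exact WeierstrassCurve.map_variableChange _ _ _
  -- the root `t = q − b₂/12` of `Ψ₃(X)` and its transport
  set t : ℚ_[3] := ((q - W.b₂ / 12 : ℚ) : ℚ_[3]) with ht
  have hqQ : 3 * (q - W.b₂ / 12) ^ 4 + W.b₂ * (q - W.b₂ / 12) ^ 3 + 3 * W.b₄ * (q - W.b₂ / 12) ^ 2 +
      3 * W.b₆ * (q - W.b₂ / 12) + W.b₈ = 0 := by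
    simp only [WeierstrassCurve.Ψ₃, eval_add, eval_mul, eval_pow, eval_C, eval_X, eval_ofNat] at hq
    linear_combination hq
  have htX : 3 * t ^ 4 + X.b₂ * t ^ 3 + 3 * X.b₄ * t ^ 2 + 3 * X.b₆ * t + X.b₈ = 0 := by
    have h0 := congrArg (fun r : ℚ ↦ ((r : ℚ) : ℚ_[3])) hqQ
    simp only [Rat.cast_add, Rat.cast_mul, Rat.cast_pow, Rat.cast_ofNat, Rat.cast_zero] at h0
    rw [hXb₂, hXb₄, hXb₆, hXb₈, ht]
    exact h0
  set x₁ : ℚ_[3] := ((Ctot.u⁻¹ : ℚ_[3]ˣ) : ℚ_[3]) ^ 2 * (t - Ctot.r) with hx₁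
  have hroot : 3 * x₁ ^ 4 + ((D • V₀).map PadicInt.Coe.ringHom).b₂ * x₁ ^ 3 +
      3 * ((D • V₀).map PadicInt.Coe.ringHom).b₄ * x₁ ^ 2 + 3 * ((D • V₀).map PadicInt.Coe.ringHom).b₆ * x₁ +
      ((D • V₀).map PadicInt.Coe.ringHom).b₈ = 0 := by
    have h := threeDivision_eval_smul X Ctot t
    rw [htX, mul_zero, hCX, halg] at h
    exact h
  have hloc := IstarZero_root_dichotomy_padicInt (D • V₀) h₁ h₂ h₃ h₄ h₆ hroot
  -- covariance of `D₀` and `A`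
  have hu0 : ((Ctot.u : ℚ_[3]ˣ) : ℚ_[3]) ≠ 0 := Units.ne_zero _
  have hDcov : 4 * x₁ ^ 3 + ((D • V₀).map PadicInt.Coe.ringHom).b₂ * x₁ ^ 2 +
      2 * ((D • V₀).map PadicInt.Coe.ringHom).b₄ * x₁ + ((D • V₀).map PadicInt.Coe.ringHom).b₆ =
      ((Ctot.u⁻¹ : ℚ_[3]ˣ) : ℚ_[3]) ^ 6 * ((W.Ψ₂Sq.eval (q - W.b₂ / 12) : ℚ) : ℚ_[3]) := by
    have h := twoDivisionDisc_eval_smul X Ctot t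
    rw [hCX, halg] at h
    rw [h]
    congr 1
    rw [hXb₂, hXb₄, hXb₆, ht]
    simp only [WeierstrassCurve.Ψ₂Sq, eval_add, eval_mul, eval_pow, eval_C, eval_X]
    push_cast; ring
  have hAcov : 10 * (12 * x₁ + ((D • V₀).map PadicInt.Coe.ringHom).b₂) ^ 2 - 9 * ((D • V₀).map PadicInt.Coe.ringHom).c₄ =
      ((Ctot.u⁻¹ : ℚ_[3]ˣ) : ℚ_[3]) ^ 4 * ((1440 * q ^ 2 - 9 * W.c₄ : ℚ) : ℚ_[3]) := by
    rw [← halg, ← hCX, variableChange_b₂, variableChange_c₄, hx₁, hXb₂, hXc₄, ht]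
    push_cast; ring
  -- `‖u‖ = 1`
  have hnormmin : ‖(X.minimal ℤ_[3]).Δ‖ = ‖X.Δ‖ := by
    rw [Padic.norm_eq_zpow_neg_valuation hminΔ, Padic.norm_eq_zpow_neg_valuation hXΔ0, padicValuation_Δ_minimal_eq X hXΔ0]
  have hΔNF : (Ctot • X).Δ = ((((D.u⁻¹ : ℤ_[3]ˣ) : ℤ_[3]) ^ 12 * V₀.Δ : ℤ_[3]) : ℚ_[3]) := by
    rw [hCX, map_Δ, variableChange_Δ, halg]; rfl
  have hnormNF : ‖(Ctot • X).Δ‖ = ‖X.Δ‖ := by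
    rw [hΔNF]; push_cast
    rw [norm_mul, norm_pow, hV₀Δc, hnormmin]
    have hDu : ‖(((D.u⁻¹ : ℤ_[3]ˣ) : ℤ_[3]) : ℚ_[3])‖ = 1 := by
      rw [← PadicInt.norm_def]; exact PadicInt.isUnit_iff.mp (Units.isUnit _)
    rw [hDu, one_pow, one_mul]
  have hun : ‖((Ctot.u⁻¹ : ℚ_[3]ˣ) : ℚ_[3])‖ = 1 := by
    have h := hnormNF
    rw [variableChange_Δ, norm_mul, norm_pow] at h
    have hX0 : ‖X.Δ‖ ≠ 0 := norm_ne_zero_iff.mpr hXΔ0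
    have h12 : ‖((Ctot.u⁻¹ : ℚ_[3]ˣ) : ℚ_[3])‖ ^ 12 = 1 := mul_right_cancel₀ hX0 (h.trans (one_mul _).symm)
    exact (pow_eq_one_iff_of_nonneg (norm_nonneg _) (by norm_num)).mp h12
  -- read the dichotomy in `ℚ`
  have hD0 : W.Ψ₂Sq.eval (q - W.b₂ / 12) ≠ 0 := velu_three_Ψ₂Sq_ne_zero W q hq
  -- `‖(r : ℚ₃)‖ = 3^{−ord₃ r}` (the tree's `PSLocalThreeTorsion.norm_ratCast_eq_three_zpow`, inlined to keep the imports light)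
  have hnorm : ∀ {r : ℚ}, r ≠ 0 → ‖(r : ℚ_[3])‖ = (3 : ℝ) ^ (-padicValRat 3 r) := fun {r} hr ↦ by
    rw [Padic.eq_padicNorm, padicNorm.eq_zpow_of_nonzero hr]
    push_cast
    norm_num
  have hnD : ‖((W.Ψ₂Sq.eval (q - W.b₂ / 12) : ℚ) : ℚ_[3])‖ = (3 : ℝ) ^ (-padicValRat 3 (W.Ψ₂Sq.eval (q - W.b₂ / 12))) :=
    hnorm hD0
  have h3 : (1 : ℝ) < 3 := by norm_num
  rcases hloc with ⟨hD1, hA4⟩ | hD3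
  · left
    rw [hDcov, norm_mul, norm_pow, hun, one_pow, one_mul, hnD] at hD1
    rw [hAcov, norm_mul, norm_pow, hun, one_pow, one_mul] at hA4
    refine ⟨?_, ?_⟩
    · have := (zpow_right_injective₀ (by norm_num : (0:ℝ) < 3) h3.ne') (hD1.trans (zpow_zero (3 : ℝ)).symm)
      simpa using this
    · by_cases hA0 : (1440 * q ^ 2 - 9 * W.c₄ : ℚ) = 0
      · exact Or.inl hA0
      · right
        rw [hnorm hA0, show ((3 : ℝ)⁻¹) ^ 4 = (3 : ℝ) ^ (-4 : ℤ) by norm_num,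
          zpow_le_zpow_iff_right₀ h3] at hA4
        omega
  · right
    rw [hDcov, norm_mul, norm_pow, hun, one_pow, one_mul, hnD,
      show ((3 : ℝ)⁻¹) ^ 3 = (3 : ℝ) ^ (-3 : ℤ) by norm_num, zpow_le_zpow_iff_right₀ h3] at hD3
    omega

end Summit.BirchSwinnertonDyer.BirchSwinnertonDyer.Theorems.ManinLocalTwoThree

end
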